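import Mathlib.Analysis.SpecialFunctions.Pow.Real
import Mathlib.Algebra.Order.BigOperators.Group.Finset
import HarnessLib

/-!
# Geometric decay from one-step subharmonicity (the iteration step of the fractional-moment method)

Topic `Literature/MathematicalPhysics/QuantumLattice`; namespace
`Literature.MathematicalPhysics.QuantumLattice.SubharmonicIteration`.

The deterministic "same-domain iteration" that ends the finite-volume fractional-moment criteria
of Aizenman–Schenker–Friedrich–Hundertmark (Commun. Math. Phys. 224 (2001) 219, proof of Thm 2,
p. 8: "iterating the inequality … as long as the boxes do not reach `y` … each iteration yields a
factor `b < 1`"): a bounded non-negative two-point quantity `f(x) = τ(x,y)` which, at every `x`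
farther than `R` from `y`, is dominated by `b` times its value at SOME point at most `R + 1` closer
to `y` (in applications: `b ·` the maximum over the outer boundary of the box `Λ_R(x)`, obtained
from the geometric resolvent identity and an a-priori bound) decays geometrically in the distance:
`f(x) ≤ M · b^{⌊d(x)/(R+1)⌋}`.

* `le_mul_pow_min_of_step` — the induction (`k` steps or until the box reaches `y`);
* `le_mul_pow_div_of_step` — **the iteration lemma**, `f x ≤ M * b ^ (d x / (R + 1))`;
* `le_mul_pow_div_of_sum_step` — the same from the SUM form of the step,
  `f x ≤ Σ_{z ∈ N x} w x z · f z` with non-negative weights of total mass `≤ b` supported on points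
  at most `R + 1` closer to `y` (the form the resolvent identity produces);
* `pow_div_le_exp_neg` — conversion of `b^{⌊d/(R+1)⌋}` into the exponential rate
  `log(1/b)/(R+1)` per unit distance (up to one factor `b⁻¹`); `pow_div_le_exp_neg_half` — the same
  beyond the first shell at half the rate with NO `b`-dependent prefactor (for `b = b_k → 0`).

Pure real analysis on an arbitrary index type with an `ℕ`-valued "distance to the target"; no
probability, no operators. [cite: AizenmanEtAl2001, proof of Thm 2 (p. 8), Lemma 6]
-/

namespace Literature.MathematicalPhysics.QuantumLattice.SubharmonicIteration

open Finset Real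

variable {V : Type*}

/-- **`k`-step iteration.** If `f ≤ M` everywhere and every point `x` with `d x > R` admits a point
`z` with `d x ≤ d z + (R+1)` and `f x ≤ b · f z` (`0 ≤ b ≤ 1`), then after `k` iterations
`f x ≤ M · b^{min(k, ⌊d x/(R+1)⌋)}`. [cite: AizenmanEtAl2001, proof of Thm 2 (p. 8)] -/
theorem le_mul_pow_min_of_step (d : V → ℕ) (f : V → ℝ) {M b : ℝ} {R : ℕ} (hM : 0 ≤ M)
    (hb : 0 ≤ b) (hb1 : b ≤ 1) (hbound : ∀ x, f x ≤ M)
    (hstep : ∀ x, R < d x → ∃ z, d x ≤ d z + (R + 1) ∧ f x ≤ b * f z) (k : ℕ) :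
    ∀ x, f x ≤ M * b ^ min k (d x / (R + 1)) := by
  induction k with
  | zero => intro x; simpa using hbound x
  | succ k ih =>
    intro x
    by_cases hfar : R < d x
    · obtain ⟨z, hdz, hfz⟩ := hstep x hfar
      have hq : d x / (R + 1) ≤ d z / (R + 1) + 1 := by
        have h1 : d x / (R + 1) ≤ (d z + (R + 1)) / (R + 1) := Nat.div_le_div_right hdz
        rwa [Nat.add_div_right _ (Nat.succ_pos R)] at h1
      have hmin : min (k + 1) (d x / (R + 1)) ≤ min k (d z / (R + 1)) + 1 := by omega
      calc f x ≤ b * f z := hfz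
        _ ≤ b * (M * b ^ min k (d z / (R + 1))) := mul_le_mul_of_nonneg_left (ih z) hb
        _ = M * b ^ (min k (d z / (R + 1)) + 1) := by ring
        _ ≤ M * b ^ min (k + 1) (d x / (R + 1)) :=
          mul_le_mul_of_nonneg_left (pow_le_pow_of_le_one hb hb1 hmin) hM
    · have h0 : d x / (R + 1) = 0 := Nat.div_eq_of_lt (by omega)
      rw [h0, Nat.min_zero, pow_zero, mul_one]
      exact hbound x

/-- **The iteration lemma of the fractional-moment method** (geometric decay from one-step
subharmonicity): under the hypotheses of `le_mul_pow_min_of_step`,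
`f x ≤ M · b^{⌊d x/(R+1)⌋}` for every `x` — one factor `b` per shell of width `R + 1` separating `x`
from the target. [cite: AizenmanEtAl2001, proof of Thm 2 (p. 8)] -/
theorem le_mul_pow_div_of_step (d : V → ℕ) (f : V → ℝ) {M b : ℝ} {R : ℕ} (hM : 0 ≤ M)
    (hb : 0 ≤ b) (hb1 : b ≤ 1) (hbound : ∀ x, f x ≤ M)
    (hstep : ∀ x, R < d x → ∃ z, d x ≤ d z + (R + 1) ∧ f x ≤ b * f z) (x : V) :
    f x ≤ M * b ^ (d x / (R + 1)) := by
  have h := le_mul_pow_min_of_step d f hM hb hb1 hbound hstep (d x / (R + 1)) x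
  rwa [min_self] at h

/-- **Sum form of the step.** If `0 ≤ f ≤ M` and at every `x` with `d x > R`,
`f x ≤ Σ_{z ∈ N x} w x z · f z` with weights `w x z ≥ 0` of total mass `≤ b ≤ 1` carried by points
`z` with `d x ≤ d z + (R+1)` (the outer boundary of the box of radius `R` about `x`), then
`f x ≤ M · b^{⌊d x/(R+1)⌋}`: the sum is at most `b · max_{N x} f`. This is the shape produced by the
geometric resolvent identity with an a-priori bound absorbed into `w`.
[cite: AizenmanEtAl2001, proof of Thm 2 (p. 8), Lemma 6] -/
theorem le_mul_pow_div_of_sum_step (d : V → ℕ) (f : V → ℝ) {M b : ℝ} {R : ℕ} (hM : 0 ≤ M)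
    (hb : 0 ≤ b) (hb1 : b ≤ 1) (hf0 : ∀ x, 0 ≤ f x) (hbound : ∀ x, f x ≤ M)
    (N : V → Finset V) (w : V → V → ℝ) (hw0 : ∀ x z, 0 ≤ w x z)
    (hwb : ∀ x, R < d x → ∑ z ∈ N x, w x z ≤ b)
    (hN : ∀ x, ∀ z ∈ N x, d x ≤ d z + (R + 1))
    (hstep : ∀ x, R < d x → f x ≤ ∑ z ∈ N x, w x z * f z) (x : V) :
    f x ≤ M * b ^ (d x / (R + 1)) := by
  refine le_mul_pow_div_of_step d f hM hb hb1 hbound (fun y hy => ?_) x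
  by_cases hne : (N y).Nonempty
  · -- step to a maximiser of `f` on `N y`
    obtain ⟨z, hz, hmax⟩ := exists_max_image (N y) f hne
    refine ⟨z, hN y z hz, (hstep y hy).trans ?_⟩
    calc ∑ u ∈ N y, w y u * f u ≤ ∑ u ∈ N y, w y u * f z :=
          sum_le_sum fun u hu => mul_le_mul_of_nonneg_left (hmax u hu) (hw0 y u)
      _ = (∑ u ∈ N y, w y u) * f z := by rw [sum_mul]
      _ ≤ b * f z := mul_le_mul_of_nonneg_right (hwb y hy) (hf0 z)
  · -- empty neighbourhood: `f y ≤ 0 ≤ b · f y`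
    rw [not_nonempty_iff_eq_empty] at hne
    have hle : f y ≤ 0 := by simpa [hne] using hstep y hy
    exact ⟨y, by omega, hle.trans (mul_nonneg hb (hf0 y))⟩

/-- **From shells to an exponential rate**: for `0 < b ≤ 1`,
`b^{⌊n/(R+1)⌋} ≤ b⁻¹ · exp(−(log b⁻¹/(R+1)) · n)` — geometric decay per shell of width `R + 1`
is exponential decay at rate `log(1/b)/(R+1)` per unit distance, up to the boundary factor `b⁻¹`
(`⌊n/(R+1)⌋ ≥ n/(R+1) − 1`). [cite: AizenmanEtAl2001, Thm 2 (rate `μ`)] -/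
theorem pow_div_le_exp_neg {b : ℝ} (hb0 : 0 < b) (hb1 : b ≤ 1) (R n : ℕ) :
    b ^ (n / (R + 1)) ≤ b⁻¹ * Real.exp (-(Real.log b⁻¹ / (R + 1) * n)) := by
  have hR : (0 : ℝ) < (R : ℝ) + 1 := by positivity
  have hlt : (n : ℝ) / (R + 1) - 1 ≤ ((n / (R + 1) : ℕ) : ℝ) := by
    have h1 : n < n / (R + 1) * (R + 1) + (R + 1) := Nat.lt_div_mul_add (Nat.succ_pos R)
    have h2 : (n : ℝ) < ((n / (R + 1) : ℕ) : ℝ) * ((R : ℝ) + 1) + ((R : ℝ) + 1) := by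
      exact_mod_cast h1
    rw [sub_le_iff_le_add, div_le_iff₀ hR]
    linarith
  have hrhs : b⁻¹ * Real.exp (-(Real.log b⁻¹ / (R + 1) * n)) = b ^ ((n : ℝ) / (R + 1) - 1) := by
    rw [Real.rpow_sub_one hb0.ne', Real.rpow_def_of_pos hb0, Real.log_inv,
      show -(-Real.log b / ((R : ℝ) + 1) * n) = Real.log b * ((n : ℝ) / (R + 1)) by ring]
    ring
  rw [hrhs, ← Real.rpow_natCast]
  exact Real.rpow_le_rpow_of_exponent_ge hb0 hb1 hlt

/-- **From shells to an exponential rate without the boundary factor** (the form with a PREFACTOR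
independent of `b`, needed when `b = b_k → 0` along a sequence): for `0 < b ≤ 1` and `n ≥ R + 1`,
`b^{⌊n/(R+1)⌋} ≤ exp(−(log b⁻¹/(2(R+1))) · n)` — half the rate, since `⌊t⌋ ≥ t/2` for `t ≥ 1`.
[cite: AizenmanEtAl2001, Thm 2 (rate `μ`)] -/
theorem pow_div_le_exp_neg_half {b : ℝ} (hb0 : 0 < b) (hb1 : b ≤ 1) (R n : ℕ) (hn : R + 1 ≤ n) :
    b ^ (n / (R + 1)) ≤ Real.exp (-(Real.log b⁻¹ / (2 * (R + 1)) * n)) := by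
  have hR : (0 : ℝ) < (R : ℝ) + 1 := by positivity
  have hq1 : 1 ≤ n / (R + 1) := (Nat.le_div_iff_mul_le (Nat.succ_pos R)).2 (by simpa using hn)
  have hlt : (n : ℝ) / (2 * (R + 1)) ≤ ((n / (R + 1) : ℕ) : ℝ) := by
    have h1 : n < n / (R + 1) * (R + 1) + (R + 1) := Nat.lt_div_mul_add (Nat.succ_pos R)
    have h2 : (n : ℝ) < ((n / (R + 1) : ℕ) : ℝ) * ((R : ℝ) + 1) + ((R : ℝ) + 1) := by
      exact_mod_cast h1
    have h3 : (1 : ℝ) ≤ ((n / (R + 1) : ℕ) : ℝ) := by exact_mod_cast hq1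
    rw [div_le_iff₀ (by positivity)]
    nlinarith
  have hrhs : Real.exp (-(Real.log b⁻¹ / (2 * (R + 1)) * n)) = b ^ ((n : ℝ) / (2 * (R + 1))) := by
    rw [Real.rpow_def_of_pos hb0, Real.log_inv,
      show -(-Real.log b / (2 * ((R : ℝ) + 1)) * n) = Real.log b * ((n : ℝ) / (2 * (R + 1))) by ring]
  rw [hrhs, ← Real.rpow_natCast]
  exact Real.rpow_le_rpow_of_exponent_ge hb0 hb1 hlt

end Literature.MathematicalPhysics.QuantumLattice.SubharmonicIteration
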